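import Summits.Ventures.LatticeQCDFlow.Exactness.FlowSamplerSquareIntegrableMonotone
import Summits.Ventures.LatticeQCDFlow.Exactness.ReversiblePoincareCeilingPositive
import HarnessLib

/-!
# The flow arm's CEILING on `L²(e^{−S})`: a weight bound `e^{−S} ≤ C q̃` forces a summable autocorrelation series and `τ_int ≤ C/Z − ½` for EVERY square-integrable observable

HONEST FRAMING: exact (Metropolis-corrected) sampling algorithms for lattice gauge theory;
figures of merit are autocorrelation/cost numbers at stated couplings and volumes; no
continuum-physics claim.  (SCALAR calibration rung S0-A: not a gauge result.)

Venture `LatticeQCDFlow` (cell pub-lqcd), topic `Exactness`; FANOUT row 2 (`s0-phi4`, FLOW arm: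
independence Metropolis `K = imhOp μ w q̃`).  NEW WORK of the cell over
`FlowSamplerSquareIntegrable{,Contraction,Positive,Monotone}` (the flow sampler as a positive
reversible contraction of all of `L²(w)`) and the format-level Poincaré ceiling for positive samplers
`RevOp.tauInt_le_of_poincare_of_nonneg` (`ReversiblePoincareCeilingPositive`).  Nothing is cited as
a fact.  Printed counterparts NAMED ONLY: Mengersen–Tweedie 1996 Thm 2.1 (the independence sampler
is uniformly ergodic iff `w/q̃` is bounded, with rate `1 − 1/W`); Liu 1996 (`λ₁ = 1 − 1/w₁`).

## What is proved (general `(X, μ)` s-finite; `w > 0` integrable, `Z = ∫ w`; `q > 0` measurable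
integrable, `∫ q = 1`; "square-integrable" = measurable with `∫ v² w < ∞`;
`𝓔(v) = ∫ v² w − ∫ v (K v) w`, `s = min(w q', w' q)`)

* `integral_mul_imhOp_mul_eq_prod_of_sq` — `∫ v (K v) w = ∫_{μ⊗μ} s v₁ v₂ + ∫ v² w r`;
* **`dirichlet_eq_half_sq_of_sq`** — THE DIRICHLET FORM ON `L²(w)`:
  `𝓔(v) = ½ ∫_{μ⊗μ} s(t,t') (v(t) − v(t'))²`;
* `imhFlow_ge_weightBound` — `w ≤ C q ⇒ s(t,t') ≥ w(t) w(t')/C`;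
* **`dirichlet_ge_weightBound_of_sq`** — THE POINCARÉ INEQUALITY: for centred square-integrable `v`
  (`∫ v w = 0`), `(Z/C) ∫ v² w ≤ 𝓔(v)`;
* **`imhOp_tauInt_le_weightBound_of_sq`** — for every centred square-integrable `g` with `∫ g² w > 0`:
  the normalised autocorrelation series IS SUMMABLE and **`τ_int(g) ≤ C/Z − ½`** — no a-priori
  summability (the operator is positive on `L²(w)`), no boundedness of `g`.

Lattice instance (every polynomial observable of lattice φ⁴ under row 2's `imhOpPhi4`, the
magnetisation's two-sided bracket `½ + r̄/(1 − r̄) ≤ τ_int(M) ≤ C/Z − ½`) is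
`Phi4FlowSquareIntegrableCeiling.lean`.
NOT CLAIMED: a weight bound for any trained network (hypothesis); sharpness beyond the two-point
example `τ = W − ½`; anything for HMC / local Metropolis.
-/

namespace Summit.Ventures.LatticeQCDFlow.Exactness

open Real MeasureTheory Filter Finset Set
open Summit.Ventures.LatticeQCDFlow.Scoring

section General

variable {X : Type*} [MeasurableSpace X] {μ : Measure X} [SFinite μ] {w q : X → ℝ}

/-! ## §1 The Dirichlet form on `L²(w)` -/

/-- `⟨v, K v⟩_w` in product form: `∫ v (K v) w = ∫_{μ⊗μ} s(p) v(p.2) v(p.1) + ∫ v² w r`. -/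
theorem integral_mul_imhOp_mul_eq_prod_of_sq (hw0 : ∀ t, 0 < w t) (hwm : Measurable w)
    (hwi : Integrable w μ) (hq0 : ∀ t, 0 < q t) (hqm : Measurable q) (hqi : Integrable q μ)
    (hq1 : ∫ t, q t ∂μ = 1) {v : X → ℝ} (hvm : Measurable v)
    (hv2 : Integrable (fun t => v t ^ 2 * w t) μ) :
    ∫ t, v t * imhOp μ w q v t * w t ∂μ
      = (∫ p, imhFlow w q p.1 p.2 * v p.2 * v p.1 ∂(μ.prod μ))
        + ∫ t, v t ^ 2 * w t * (∫ t', (1 - imhAcceptQ w q t t') * q t' ∂μ) ∂μ := by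
  obtain ⟨hr0, hr1, hrm⟩ := rejection_bounds (μ := μ) hw0 hwm hq0 hqm hqi hq1
  have hvw := integrable_mul_weight_of_sq (fun t => (hw0 t).le) hwm hwi hvm hv2
  have hpt : ∀ t, v t * imhOp μ w q v t * w t
      = (∫ t', imhFlow w q t t' * v t' * v t ∂μ)
        + v t ^ 2 * w t * ∫ t', (1 - imhAcceptQ w q t t') * q t' ∂μ := by
    intro t
    have e := imhOp_mul_mul_weight_eq hw0 hwm hq0 hqm hqi hvm hvw t (v t)
    calc v t * imhOp μ w q v t * w t = imhOp μ w q v t * v t * w t := by ring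
      _ = (∫ t', imhFlow w q t t' * v t' * v t ∂μ)
          + v t * v t * w t * ∫ t', (1 - imhAcceptQ w q t t') * q t' ∂μ := e
      _ = _ := by ring
  have hP := integrable_imhFlow_mul_mul_of_sq hw0 hwm hq0 hqm hqi hvm hvm hv2 hv2
  have hI2 : Integrable (fun t => v t ^ 2 * w t * ∫ t', (1 - imhAcceptQ w q t t') * q t' ∂μ) μ := by
    refine Integrable.mono' hv2 (((hvm.pow_const 2).mul hwm).mul hrm).aestronglyMeasurable
      (Eventually.of_forall fun t => ?_)
    rw [Real.norm_eq_abs, abs_mul, abs_of_nonneg (mul_nonneg (sq_nonneg _) (hw0 t).le),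
      abs_of_nonneg (hr0 t)]
    exact mul_le_of_le_one_right (mul_nonneg (sq_nonneg _) (hw0 t).le) (hr1 t)
  rw [integral_congr_ae (Eventually.of_forall hpt), integral_add hP.integral_prod_left hI2,
    integral_prod _ hP]

/-- The rejection term in product form: `∫ v² w r = ∫ v² w − ∫_{μ⊗μ} s(p) v(p.1)²`
(`w(t)(1 − r(t)) = ∫ s(t,t') dt'`). -/
theorem integral_sq_mul_rejection_eq_of_sq (hw0 : ∀ t, 0 < w t) (hwm : Measurable w)
    (hq0 : ∀ t, 0 < q t) (hqm : Measurable q) (hqi : Integrable q μ)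
    (hq1 : ∫ t, q t ∂μ = 1) {v : X → ℝ} (hvm : Measurable v)
    (hv2 : Integrable (fun t => v t ^ 2 * w t) μ) :
    ∫ t, v t ^ 2 * w t * (∫ t', (1 - imhAcceptQ w q t t') * q t' ∂μ) ∂μ
      = (∫ t, v t ^ 2 * w t ∂μ) - ∫ p, imhFlow w q p.1 p.2 * v p.1 ^ 2 ∂(μ.prod μ) := by
  have hP : Integrable (fun p : X × X => imhFlow w q p.1 p.2 * v p.1 ^ 2) (μ.prod μ) :=
    integrable_imhFlow_mul_fst hw0 hwm hq0 hqm hqi (hvm.pow_const 2) hv2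
  have hpt : ∀ t, v t ^ 2 * w t * (∫ t', (1 - imhAcceptQ w q t t') * q t' ∂μ)
      = v t ^ 2 * w t - ∫ t', imhFlow w q t t' * v t ^ 2 ∂μ := by
    intro t
    rw [rejection_eq_rejCurve hw0 hq0 t]
    have h := integral_imhFlow_eq hw0 hwm hq0 hqm hqi hq1 t
    have e : ∫ t', imhFlow w q t t' * v t ^ 2 ∂μ = (∫ t', imhFlow w q t t' ∂μ) * v t ^ 2 :=
      integral_mul_const _ _
    rw [e, h]
    ring
  rw [integral_congr_ae (Eventually.of_forall hpt), integral_sub hv2 hP.integral_prod_left,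
    integral_prod _ hP]

/-- **THE DIRICHLET FORM OF THE FLOW SAMPLER ON `L²(w)`**:
`∫ v² w − ∫ v (K v) w = ½ ∫_{μ⊗μ} s(t,t') (v(t) − v(t'))²` for every measurable square-integrable
`v` (Fubini + symmetry of `s`; no boundedness). -/
theorem dirichlet_eq_half_sq_of_sq (hw0 : ∀ t, 0 < w t) (hwm : Measurable w)
    (hwi : Integrable w μ) (hq0 : ∀ t, 0 < q t) (hqm : Measurable q) (hqi : Integrable q μ)
    (hq1 : ∫ t, q t ∂μ = 1) {v : X → ℝ} (hvm : Measurable v)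
    (hv2 : Integrable (fun t => v t ^ 2 * w t) μ) :
    (∫ t, v t ^ 2 * w t ∂μ) - ∫ t, v t * imhOp μ w q v t * w t ∂μ
      = (1 / 2) * ∫ p, imhFlow w q p.1 p.2 * (v p.1 - v p.2) ^ 2 ∂(μ.prod μ) := by
  have hA : Integrable (fun p : X × X => imhFlow w q p.1 p.2 * v p.1 ^ 2) (μ.prod μ) :=
    integrable_imhFlow_mul_fst hw0 hwm hq0 hqm hqi (hvm.pow_const 2) hv2
  have hB : Integrable (fun p : X × X => imhFlow w q p.1 p.2 * v p.2 ^ 2) (μ.prod μ) :=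
    integrable_imhFlow_mul_snd hw0 hwm hq0 hqm hqi (hvm.pow_const 2) hv2
  have hC := integrable_imhFlow_mul_mul_of_sq hw0 hwm hq0 hqm hqi hvm hvm hv2 hv2
  -- symmetry: `∫∫ s v₁² = ∫∫ s v₂²`
  have hswap : ∫ p, imhFlow w q p.1 p.2 * v p.2 ^ 2 ∂(μ.prod μ)
      = ∫ p, imhFlow w q p.1 p.2 * v p.1 ^ 2 ∂(μ.prod μ) := by
    rw [← integral_prod_swap]
    refine integral_congr_ae (Eventually.of_forall fun p => ?_)
    show imhFlow w q p.swap.1 p.swap.2 * v p.swap.2 ^ 2 = imhFlow w q p.1 p.2 * v p.1 ^ 2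
    simp only [Prod.fst_swap, Prod.snd_swap]
    rw [imhFlow_symm]
  have e : ∀ p : X × X, imhFlow w q p.1 p.2 * (v p.1 - v p.2) ^ 2
      = imhFlow w q p.1 p.2 * v p.1 ^ 2 + imhFlow w q p.1 p.2 * v p.2 ^ 2
        - 2 * (imhFlow w q p.1 p.2 * v p.2 * v p.1) := fun p => by ring
  simp_rw [e]
  have hAB : Integrable (fun p : X × X => imhFlow w q p.1 p.2 * v p.1 ^ 2
      + imhFlow w q p.1 p.2 * v p.2 ^ 2) (μ.prod μ) := hA.add hB
  have hC2 : Integrable (fun p : X × X => 2 * (imhFlow w q p.1 p.2 * v p.2 * v p.1)) (μ.prod μ) :=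
    hC.const_mul 2
  rw [integral_sub hAB hC2, integral_add hA hB, integral_const_mul, hswap,
    integral_mul_imhOp_mul_eq_prod_of_sq hw0 hwm hwi hq0 hqm hqi hq1 hvm hv2,
    integral_sq_mul_rejection_eq_of_sq hw0 hwm hq0 hqm hqi hq1 hvm hv2]
  ring

/-! ## §2 The Poincaré inequality from a weight bound -/

omit [MeasurableSpace X] [SFinite μ] in
/-- **A weight bound minorises the symmetrised flow by a rank-one kernel**:
`w ≤ C q ⇒ w(t) w(t')/C ≤ s(t,t')`. -/
theorem imhFlow_ge_weightBound (hw0 : ∀ t, 0 < w t) (hq0 : ∀ t, 0 < q t) {C : ℝ}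
    (hC : ∀ t, w t ≤ C * q t) (t t' : X) : w t * w t' / C ≤ imhFlow w q t t' := by
  have hCpos : 0 < C := by
    have h := hC t
    exact pos_of_mul_pos_left ((hw0 t).trans_le h) (hq0 t).le
  unfold imhFlow
  rw [div_le_iff₀ hCpos]
  refine (min_mul_of_nonneg _ _ hCpos.le).symm ▸ le_min ?_ ?_
  · calc w t * w t' ≤ w t * (C * q t') := mul_le_mul_of_nonneg_left (hC t') (hw0 t).le
      _ = w t * q t' * C := by ring
  · calc w t * w t' ≤ (C * q t) * w t' := mul_le_mul_of_nonneg_right (hC t) (hw0 t').le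
      _ = w t' * q t * C := by ring

/-- **THE POINCARÉ INEQUALITY OF THE FLOW SAMPLER UNDER A WEIGHT BOUND, on `L²(w)`**: if `w ≤ C q`
then for every centred measurable square-integrable `v` (`∫ v w = 0`):
`(Z/C) ∫ v² w ≤ ∫ v² w − ∫ v (K v) w`, `Z = ∫ w`. -/
theorem dirichlet_ge_weightBound_of_sq (hw0 : ∀ t, 0 < w t) (hwm : Measurable w)
    (hwi : Integrable w μ) (hq0 : ∀ t, 0 < q t) (hqm : Measurable q) (hqi : Integrable q μ)
    (hq1 : ∫ t, q t ∂μ = 1) {C : ℝ} (hC : ∀ t, w t ≤ C * q t) {v : X → ℝ} (hvm : Measurable v)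
    (hv2 : Integrable (fun t => v t ^ 2 * w t) μ) (hv0 : ∫ t, v t * w t ∂μ = 0) :
    (∫ t, w t ∂μ) / C * ∫ t, v t ^ 2 * w t ∂μ
      ≤ (∫ t, v t ^ 2 * w t ∂μ) - ∫ t, v t * imhOp μ w q v t * w t ∂μ := by
  have hCpos : 0 < C := by
    obtain ⟨t⟩ : Nonempty X := by
      by_contra h
      rw [not_nonempty_iff] at h
      have : ∫ t, q t ∂μ = 0 := by
        rw [Measure.eq_zero_of_isEmpty μ]; simp
      rw [this] at hq1; exact zero_ne_one hq1
    have h := hC t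
    exact pos_of_mul_pos_left ((hw0 t).trans_le h) (hq0 t).le
  have hvw := integrable_mul_weight_of_sq (fun t => (hw0 t).le) hwm hwi hvm hv2
  rw [dirichlet_eq_half_sq_of_sq hw0 hwm hwi hq0 hqm hqi hq1 hvm hv2]
  -- the rank-one form: `½ ∫∫ (w w'/C)(v − v')² = (Z ∫ v² w − (∫ v w)²)/C`
  have hWW : Integrable (fun p : X × X => (v p.1 ^ 2 * w p.1) * w p.2) (μ.prod μ) := hv2.mul_prod hwi
  have hWW' : Integrable (fun p : X × X => w p.1 * (v p.2 ^ 2 * w p.2)) (μ.prod μ) := hwi.mul_prod hv2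
  have hVV : Integrable (fun p : X × X => (v p.1 * w p.1) * (v p.2 * w p.2)) (μ.prod μ) :=
    hvw.mul_prod hvw
  have hL : Integrable (fun p : X × X => w p.1 * w p.2 / C * (v p.1 - v p.2) ^ 2) (μ.prod μ) := by
    have h := ((hWW.add hWW').sub (hVV.const_mul 2)).const_mul (1 / C)
    refine h.congr (Eventually.of_forall fun p => ?_)
    show 1 / C * ((v p.1 ^ 2 * w p.1) * w p.2 + w p.1 * (v p.2 ^ 2 * w p.2)
      - 2 * ((v p.1 * w p.1) * (v p.2 * w p.2))) = w p.1 * w p.2 / C * (v p.1 - v p.2) ^ 2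
    field_simp
    ring
  have hR : Integrable (fun p : X × X => imhFlow w q p.1 p.2 * (v p.1 - v p.2) ^ 2) (μ.prod μ) := by
    have hA : Integrable (fun p : X × X => imhFlow w q p.1 p.2 * v p.1 ^ 2) (μ.prod μ) :=
      integrable_imhFlow_mul_fst hw0 hwm hq0 hqm hqi (hvm.pow_const 2) hv2
    have hB : Integrable (fun p : X × X => imhFlow w q p.1 p.2 * v p.2 ^ 2) (μ.prod μ) :=
      integrable_imhFlow_mul_snd hw0 hwm hq0 hqm hqi (hvm.pow_const 2) hv2
    have hAB := integrable_imhFlow_mul_mul_of_sq hw0 hwm hq0 hqm hqi hvm hvm hv2 hv2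
    refine ((hA.add hB).sub (hAB.const_mul 2)).congr (Eventually.of_forall fun p => ?_)
    show imhFlow w q p.1 p.2 * v p.1 ^ 2 + imhFlow w q p.1 p.2 * v p.2 ^ 2
      - 2 * (imhFlow w q p.1 p.2 * v p.2 * v p.1) = imhFlow w q p.1 p.2 * (v p.1 - v p.2) ^ 2
    ring
  have hmono : ∫ p, w p.1 * w p.2 / C * (v p.1 - v p.2) ^ 2 ∂(μ.prod μ)
      ≤ ∫ p, imhFlow w q p.1 p.2 * (v p.1 - v p.2) ^ 2 ∂(μ.prod μ) :=
    integral_mono hL hR fun p => mul_le_mul_of_nonneg_right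
      (imhFlow_ge_weightBound hw0 hq0 hC p.1 p.2) (sq_nonneg _)
  have hval : ∫ p, w p.1 * w p.2 / C * (v p.1 - v p.2) ^ 2 ∂(μ.prod μ)
      = 2 * ((∫ t, w t ∂μ) * ∫ t, v t ^ 2 * w t ∂μ) / C := by
    have e : ∀ p : X × X, w p.1 * w p.2 / C * (v p.1 - v p.2) ^ 2
        = 1 / C * ((v p.1 ^ 2 * w p.1) * w p.2 + w p.1 * (v p.2 ^ 2 * w p.2)
          - 2 * ((v p.1 * w p.1) * (v p.2 * w p.2))) := fun p => by
      field_simp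
      ring
    simp_rw [e]
    have hS : Integrable (fun p : X × X => (v p.1 ^ 2 * w p.1) * w p.2 + w p.1 * (v p.2 ^ 2 * w p.2))
        (μ.prod μ) := hWW.add hWW'
    have hV2 : Integrable (fun p : X × X => 2 * ((v p.1 * w p.1) * (v p.2 * w p.2))) (μ.prod μ) :=
      hVV.const_mul 2
    rw [integral_const_mul, integral_sub hS hV2, integral_add hWW hWW',
      integral_const_mul,
      integral_prod_mul (μ := μ) (ν := μ) (fun t => v t ^ 2 * w t) (fun t => w t),
      integral_prod_mul (μ := μ) (ν := μ) (fun t => w t) (fun t => v t ^ 2 * w t),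
      integral_prod_mul (μ := μ) (ν := μ) (fun t => v t * w t) (fun t => v t * w t), hv0]
    field_simp
    ring
  rw [hval] at hmono
  have e2 : (∫ t, w t ∂μ) / C * ∫ t, v t ^ 2 * w t ∂μ
      = 1 / 2 * (2 * ((∫ t, w t ∂μ) * ∫ t, v t ^ 2 * w t ∂μ) / C) := by
    field_simp
  rw [e2]
  exact mul_le_mul_of_nonneg_left hmono (by norm_num)

/-! ## §3 The ceiling -/

/-- **THE FLOW ARM'S CEILING ON `L²(w)`**: if `w ≤ C q` then for every centred measurable
square-integrable `g` (`∫ g w = 0`, `∫ g² w > 0`) the normalised autocorrelation series of `g` under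
`K = imhOp μ w q` IS SUMMABLE and `τ_int(g) ≤ C/Z − ½` (`Z = ∫ w`) — the magnetisation included;
no a-priori summability (all autocovariances are `≥ 0` on `L²(w)`). -/
theorem imhOp_tauInt_le_weightBound_of_sq (hw0 : ∀ t, 0 < w t) (hwm : Measurable w)
    (hwi : Integrable w μ) (hq0 : ∀ t, 0 < q t) (hqm : Measurable q) (hqi : Integrable q μ)
    (hq1 : ∫ t, q t ∂μ = 1) {C : ℝ} (hC : ∀ t, w t ≤ C * q t) {g : X → ℝ} (hgm : Measurable g)
    (hg2 : Integrable (fun t => g t ^ 2 * w t) μ) (hg0 : ∫ t, g t * w t ∂μ = 0)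
    (hP : 0 < ∫ t, g t ^ 2 * w t ∂μ) :
    (Summable fun n => (∫ t, g t * ((imhOp μ w q)^[n + 1] g) t * w t ∂μ)
      / ∫ t, g t ^ 2 * w t ∂μ) ∧
    tauInt (fun n => (∫ t, g t * ((imhOp μ w q)^[n] g) t * w t ∂μ) / ∫ t, g t ^ 2 * w t ∂μ)
      ≤ 1 / ((∫ t, w t ∂μ) / C) - 1 / 2 := by
  have hw0' : ∀ t, 0 ≤ w t := fun t => (hw0 t).le
  have hZ : 0 < ∫ t, w t ∂μ := integral_pos_of_pos hw0 hwi hq1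
  have hCpos : 0 < C := by
    obtain ⟨t⟩ : Nonempty X := by
      by_contra h
      rw [not_nonempty_iff] at h
      have : ∫ t, q t ∂μ = 0 := by
        rw [Measure.eq_zero_of_isEmpty μ]; simp
      rw [this] at hq1; exact zero_ne_one hq1
    have h := hC t
    exact pos_of_mul_pos_left ((hw0 t).trans_le h) (hq0 t).le
  have hγ : 0 < (∫ t, w t ∂μ) / C := div_pos hZ hCpos
  -- `1 ∈ L²(w)` and `K 1 = 1`
  have h1 : Measurable (fun _ : X => (1 : ℝ)) ∧ Integrable (fun t => (1 : ℝ) ^ 2 * w t) μ :=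
    ⟨measurable_const, by simpa using hwi⟩
  have hunit : ∀ x, imhOp μ w q (fun _ => (1 : ℝ)) x = 1 := fun x => imhOp_one hq1 x
  -- the Poincaré hypothesis on centred class members
  have hPoinc : ∀ ⦃u : X → ℝ⦄, (Measurable u ∧ Integrable (fun t => u t ^ 2 * w t) μ) →
      ∫ x, u x * w x ∂μ = 0 →
      (∫ t, w t ∂μ) / C * ∫ x, u x ^ 2 * w x ∂μ
        ≤ (∫ x, u x ^ 2 * w x ∂μ) - ∫ x, u x * imhOp μ w q u x * w x ∂μ :=
    fun u hu hu0 => dirichlet_ge_weightBound_of_sq hw0 hwm hwi hq0 hqm hqi hq1 hC hu.1 hu.2 hu0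
  -- all autocovariances are nonnegative
  have hpos : ∀ k, 0 ≤ ∫ x, g x * ((imhOp μ w q)^[k] g) x * w x ∂μ := by
    intro k
    cases k with
    | zero =>
      simp only [Function.iterate_zero, id_eq]
      exact integral_nonneg fun x => mul_nonneg (mul_self_nonneg _) (hw0' x)
    | succ k => exact (imhOp_autocov_shape_of_sq hw0 hwm hwi hq0 hqm hqi hq1 hgm hg2 k).1
  exact RevOp.tauInt_le_of_poincare_of_nonneg (A := fun f : X → ℝ => Measurable f ∧
      Integrable (fun t => f t ^ 2 * w t) μ) (K := imhOp μ w q) hw0' h1 (sqClass_int hw0 hwm)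
    (sqClass_comb hw0 hwm) (sqClass_stab hw0 hwm hwi hq0 hqm hqi hq1)
    (sqClass_lin hw0 hwm hwi hq0 hqm hqi) (sqClass_symm hw0 hwm hwi hq0 hqm hqi hq1)
    (sqClass_contr hw0 hwm hwi hq0 hqm hqi hq1) hunit hZ hγ hPoinc ⟨hgm, hg2⟩ hg0 hP hpos

end General

end Summit.Ventures.LatticeQCDFlow.Exactness
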